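import Literature.MathematicalPhysics.QuantumLattice.SpinChainsKnabeProofs
import Mathlib.Algebra.BigOperators.Intervals
import HarnessLib

/-!
# Knabe's finite-size criterion for frustration-free periodic chains — blocks of arbitrary length

Trunk **T-QLATTICE**; theorem-only sequel of `SpinChainsKnabeProofs.lean` (no definition, no named fact), which
proves Knabe's inequality for FOUR-site blocks (`knabe_ring_sq_sub_smul_posSemidef`: local gap `ε` on three
consecutive bond projections ⇒ `H² ≥ (3ε-1)/2 · H`).  Here the block length is arbitrary, as in the printed theorem
(this discharges the one-dimensional periodic part of the `TODO(general form)` recorded in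
`Literature/Analysis/OperatorTheory/KnabeGapAmplification.lean`).

AS PRINTED.  S. Knabe, J. Stat. Phys. 52 (1988) 627, §2, restated as Theorem 1 of D. Gosset, E. Mozgunov,
J. Math. Phys. 57 (2016) 091901 (arXiv:1512.00088, §2): for the periodic chain `H°_m = Σ_{i=1}^{m} h_{i,i+1}` of
nearest-neighbour projectors (`h² = h`) and the open sub-chains `H_n = Σ_{i=1}^{n-1} h_{i,i+1}` with smallest
non-zero eigenvalues `ε°_m`, `ε_n`: "**Theorem 1 (Knabe).** Let `n > 2` and `m > n`. Then
`ε°_m ≥ ((n-1)/(n-2)) (ε_n - 1/(n-1))`"; §2.1: "Knabe's proof of Theorem 1 is based on comparing the operators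
`(H°_m)²` and `Σ_{k=1}^{m} A²_{n,k}` [`A_{n,k} = Σ_{i=k}^{n-2+k} h_{i,i+1}`] … one obtains an inequality
`(H°_m)² + β H°_m ≥ α Σ_k A²_{n,k}` where `α = β = 1/(n-2)` … `A²_{n,k} ≥ ε_n A_{n,k}` and therefore
`Σ_k A²_{n,k} ≥ ε_n Σ_k A_{n,k} = ε_n γ H°_m` where `γ = n-1` …
`(H°_m)² ≥ αγ (ε_n - β/(αγ)) H°_m`."

PROVED HERE, in the vocabulary of `SpinChainsKnabeProofs.lean` (a family `P : ℤ/N → M_n(ℂ)` of orthogonal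
projections commuting unless their indices differ by `0, ±1`; blocks of `b = n - 1` consecutive projections
`A_i = Σ_{j<b} P_{i+j}`, ring of `N = m ≥ b + 2` bonds):

* `sum_range_sum_range_sub_natCast` — the window resummation `Σ_{j,l<b} F(l-j) + b F(0) = Σ_{t<b} (b-t)(F(t) + F(-t))`;
* ★ `knabe_ring_block_sq_sub_smul_posSemidef` — local gap `A_i² ≥ ε A_i` for all `i` ⇒
  `H² - ((bε - 1)/(b - 1)) H ≥ 0`, via the EXACT identity
  `(b-1) H² - (bε-1) H = Σ_i (A_i² - ε A_i) + Σ_{t=2}^{N-2} ((b-1) - (b-t)₊ - (b-(N-t))₊) · S(t)`,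
  `S(t) = Σ_i P_i P_{i+t} ≥ 0` (products of commuting projections), whose integer coefficients are `≥ 1` exactly in
  the printed range `N ≥ b + 2` (`m > n`; for `b + 2 ≤ N ≤ 2b - 2` the offsets `t` and `N - t` of one window
  coincide on the ring, which is what the truncated subtractions book-keep);
* `knabe_ring_sq_sub_smul_posSemidef_sites` — the same with the printed parametrisation by the number of sites
  `n = b + 1` of a block: `H² - ((n-1)/(n-2)) (ε - 1/(n-1)) H ≥ 0`;
* `eigenvalue_eq_zero_or_le_of_sq_sub_smul_posSemidef` (reading lemma: `A ≥ 0` and `A² - c A ≥ 0` ⇒ every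
  eigenvalue of `A` is `0` or `≥ c`) and ★ `knabe_ring_block_eigenvalue_eq_zero_or_le` — the printed form:
  every non-zero eigenvalue of `H` is `≥ (bε - 1)/(b - 1)`, i.e. `ε°_m ≥ ((n-1)/(n-2))(ε_n - 1/(n-1))`.

HONEST FRAMING: finite-dimensional linear algebra about frustration-free sums of projections (the archetype of a
"local gap ⇒ global gap" finite-size criterion); nothing here concerns transfer matrices of lattice gauge theories,
which are not frustration-free.  The improved threshold `6/(n(n+1))` of Gosset–Mozgunov (Thm. 3, which uses
translation invariance through their Lemma 4) is not formalised here.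

## References
* S. Knabe, *Energy gaps and elementary excitations for certain VBS-quantum antiferromagnets*, J. Stat. Phys.
  **52** (1988) 627–638, §2. [Knabe1988]
* D. Gosset, E. Mozgunov, *Local gap threshold for frustration-free spin systems*, J. Math. Phys. **57** (2016)
  091901, arXiv:1512.00088, §2 Thm. 1, Cor. 2, §2.1. [GossetMozgunov2016]
-/

noncomputable section

open Matrix Complex Finset
open scoped ComplexOrder

namespace Literature.MathematicalPhysics.QuantumLattice

section KnabeBlock


/-- Pair-difference resummation on a window of `b` consecutive indices: for any `F` on `ℤ/N`,
`Σ_{j,l<b} F(l − j) + b·F(0) = Σ_{t<b} (b − t)·(F(t) + F(−t))` (the offset `±t` occurs `b − t`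
times among the ordered pairs of a window of length `b`; the diagonal `t = 0` is counted twice on
the right) — the pair counting of Knabe's squaring argument, i.e. the evaluation of `Σ_k B²_{n,k}` in
Gosset–Mozgunov §2.2 (coefficient `Σ_{r=0}^{n-2-d} c_r c_{r+d}` of the pairs at distance `d`) for the unweighted
blocks `c_j = 1`. [cite: GossetMozgunov2016, §2.2] [cite: Knabe1988, §2] -/
theorem sum_range_sum_range_sub_natCast {M : Type*} [AddCommMonoid M] {N : ℕ}
    (F : ZMod N → M) (b : ℕ) :
    (∑ j ∈ range b, ∑ l ∈ range b, F ((l : ZMod N) - (j : ZMod N))) + b • F 0 =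
      ∑ t ∈ range b, (b - t) • (F (t : ZMod N) + F (-(t : ZMod N))) := by
  induction b with
  | zero => simp
  | succ b ih =>
    -- the two reflected boundary sums
    have hrefl1 : ∑ j ∈ range b, F (((b + 1 : ℕ) : ZMod N) - 1 - (j : ZMod N)) =
        ∑ t ∈ range b, F ((t : ZMod N) + 1) := by
      rw [← sum_range_reflect (fun t => F ((t : ZMod N) + 1)) b]
      refine sum_congr rfl fun j hj => ?_
      rw [mem_range] at hj
      have h1 : ((b - 1 - j : ℕ) : ZMod N) + 1 = ((b + 1 : ℕ) : ZMod N) - 1 - (j : ZMod N) := by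
        rw [Nat.cast_sub (by omega), Nat.cast_sub (by omega)]
        push_cast
        ring
      rw [h1]
    have hrefl2 : ∑ l ∈ range b, F ((l : ZMod N) - (((b + 1 : ℕ) : ZMod N) - 1)) =
        ∑ t ∈ range b, F (-((t : ZMod N) + 1)) := by
      rw [← sum_range_reflect (fun t => F (-((t : ZMod N) + 1))) b]
      refine sum_congr rfl fun l hl => ?_
      rw [mem_range] at hl
      have h1 : -(((b - 1 - l : ℕ) : ZMod N) + 1) = (l : ZMod N) - (((b + 1 : ℕ) : ZMod N) - 1) := by
        rw [Nat.cast_sub (by omega), Nat.cast_sub (by omega)]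
        push_cast
        ring
      rw [h1]
    -- shifting the one-sided sums
    have hshift1 : ∑ t ∈ range b, F (t : ZMod N) + F (b : ZMod N) =
        ∑ t ∈ range b, F ((t : ZMod N) + 1) + F 0 := by
      rw [← sum_range_succ (fun t => F (t : ZMod N)) b, sum_range_succ' (fun t => F (t : ZMod N)) b]
      push_cast
      rfl
    have hshift2 : ∑ t ∈ range b, F (-(t : ZMod N)) + F (-(b : ZMod N)) =
        ∑ t ∈ range b, F (-((t : ZMod N) + 1)) + F 0 := by
      rw [← sum_range_succ (fun t => F (-(t : ZMod N))) b,
        sum_range_succ' (fun t => F (-(t : ZMod N))) b]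
      push_cast
      rw [neg_zero]
    -- the left side at `b + 1`
    have hb1 : ((b + 1 : ℕ) : ZMod N) - 1 = (b : ZMod N) := by push_cast; ring
    have hL : (∑ j ∈ range (b + 1), ∑ l ∈ range (b + 1), F ((l : ZMod N) - (j : ZMod N))) =
        (∑ j ∈ range b, ∑ l ∈ range b, F ((l : ZMod N) - (j : ZMod N))) +
          ∑ t ∈ range b, F ((t : ZMod N) + 1) + ∑ t ∈ range b, F (-((t : ZMod N) + 1)) + F 0 := by
      rw [sum_range_succ, sum_congr rfl fun j _ => sum_range_succ _ _, sum_range_succ,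
        sum_add_distrib]
      rw [hb1] at hrefl1 hrefl2
      rw [hrefl1, hrefl2, sub_self]
      abel
    -- the right side at `b + 1`
    have hR : ∑ t ∈ range (b + 1), (b + 1 - t) • (F (t : ZMod N) + F (-(t : ZMod N))) =
        ∑ t ∈ range b, (b - t) • (F (t : ZMod N) + F (-(t : ZMod N))) +
          (∑ t ∈ range b, F (t : ZMod N) + F (b : ZMod N)) +
          (∑ t ∈ range b, F (-(t : ZMod N)) + F (-(b : ZMod N))) := by
      have e : ∀ t ∈ range b, (b + 1 - t) • (F (t : ZMod N) + F (-(t : ZMod N))) =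
          (b - t) • (F (t : ZMod N) + F (-(t : ZMod N))) + (F (t : ZMod N) + F (-(t : ZMod N))) := by
        intro t ht
        rw [mem_range] at ht
        rw [show b + 1 - t = (b - t) + 1 by omega, succ_nsmul]
      rw [sum_range_succ, Nat.add_sub_cancel_left, one_smul, sum_congr rfl e, sum_add_distrib,
        sum_add_distrib]
      abel
    rw [hL, hR, ← ih, hshift1, hshift2, succ_nsmul]
    abel

variable {n : Type*} [Fintype n]

/-- **Knabe's finite-size criterion for a periodic chain, blocks of arbitrary length.**  Let
`P : ℤ/N → M_n(ℂ)` be orthogonal projections (`P_iᴴ = P_i = P_i²`) such that `P_i` commutes with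
`P_{i+d}` unless `d ∈ {0, 1, -1}` (nearest-neighbour bond projections on a ring of `N` bonds), let
`b ≥ 2` with `N ≥ b + 2`, and suppose that every block of `b` consecutive projections
`A_i = Σ_{j<b} P_{i+j}` (the open sub-chain of `b + 1` sites) has local gap `ε`:
`A_i² - ε A_i ≥ 0`.  Then `H = Σ_i P_i` satisfies `H² - ((bε - 1)/(b - 1)) H ≥ 0`, i.e. with
`n = b + 1` sites per block and `m = N > n` sites on the ring,
`H² ≥ ((n-1)/(n-2)) (ε_n - 1/(n-1)) H` — Knabe's Theorem 1 as restated by Gosset–Mozgunov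
("Let `n > 2` and `m > n`. Then `ε°_m ≥ ((n-1)/(n-2))(ε_n - 1/(n-1))`", the operator inequality
behind it being `(H°_m)² + β H°_m ≥ α Σ_k A²_{n,k}` with `α = β = 1/(n-2)` and
`Σ_k A_{n,k} = (n-1) H°_m`).  Proof (Knabe's squaring argument): with the pair sums
`S(d) = Σ_i P_i P_{i+d}` one has `H² = Σ_d S(d)`, `S(0) = H`,
`Σ_k A_k² = b S(0) + (b-1)(S(1) + S(-1)) + Σ_{2 ≤ t < b} (b - t)(S(t) + S(-t))`
(`sum_range_sum_range_sub_natCast`), whence the exact identity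
`(b-1) H² - (bε-1) H = Σ_k (A_k² - ε A_k) + Σ_{t=2}^{N-2} ((b-1) - (b-t)₊ - (b-(N-t))₊) S(t)`,
and `S(t) ≥ 0` for `2 ≤ t ≤ N - 2` (products of commuting projections), the integer coefficients
being `≥ 0` exactly when `N ≥ b + 2`.  The case `b = 3` is `knabe_ring_sq_sub_smul_posSemidef`.
[cite: Knabe1988, §2 Thm. 1] [cite: GossetMozgunov2016, Thm. 1 and §2.1] -/
theorem knabe_ring_block_sq_sub_smul_posSemidef {N : ℕ} [NeZero N] {b : ℕ} (hb : 2 ≤ b)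
    (hN : b + 2 ≤ N) (P : ZMod N → Matrix n n ℂ) (hherm : ∀ i, (P i).IsHermitian)
    (hidem : ∀ i, P i * P i = P i)
    (hcomm : ∀ i d : ZMod N, d ≠ 0 → d ≠ 1 → d ≠ -1 → P i * P (i + d) = P (i + d) * P i)
    (ε : ℝ)
    (hloc : ∀ i : ZMod N,
      ((∑ j ∈ range b, P (i + (j : ZMod N))) * (∑ j ∈ range b, P (i + (j : ZMod N))) -
        (ε : ℂ) • ∑ j ∈ range b, P (i + (j : ZMod N))).PosSemidef) :
    ((∑ i, P i) * (∑ i, P i) - (((b * ε - 1) / (b - 1) : ℝ) : ℂ) • ∑ i, P i).PosSemidef := by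
  -- notation
  set H : Matrix n n ℂ := ∑ i, P i with hH
  set S : ZMod N → Matrix n n ℂ := fun d => ∑ i : ZMod N, P i * P (i + d) with hS
  set A : ZMod N → Matrix n n ℂ := fun i => ∑ j ∈ range b, P (i + (j : ZMod N)) with hA
  have hN1 : 1 ≤ N := by omega
  -- residues
  have hm1 : (-1 : ZMod N) = ((N - 1 : ℕ) : ZMod N) := by
    rw [Nat.cast_sub hN1, ZMod.natCast_self, zero_sub, Nat.cast_one]
  have hne0 : ∀ t : ℕ, 2 ≤ t → t < N - 1 → (t : ZMod N) ≠ 0 := fun t ht1 ht2 => by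
    exact_mod_cast natCast_ne_natCast_zmod (N := N) (a := t) (b := 0) (by omega) (by omega)
      (by omega)
  have hne1 : ∀ t : ℕ, 2 ≤ t → t < N - 1 → (t : ZMod N) ≠ 1 := fun t ht1 ht2 => by
    exact_mod_cast natCast_ne_natCast_zmod (N := N) (a := t) (b := 1) (by omega) (by omega)
      (by omega)
  have hnem1 : ∀ t : ℕ, 2 ≤ t → t < N - 1 → (t : ZMod N) ≠ -1 := fun t ht1 ht2 => by
    rw [hm1]
    exact natCast_ne_natCast_zmod (N := N) (by omega) (by omega) (by omega)
  -- positivity of the building blocks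
  have hSpos : ∀ d : ZMod N, d ≠ 0 → d ≠ 1 → d ≠ -1 → (S d).PosSemidef := by
    intro d hd0 hd1 hdm1
    exact posSemidef_sum _ fun i _ =>
      posSemidef_mul_of_commute (hherm i) (hidem i) (hherm _) (hidem _) (hcomm i d hd0 hd1 hdm1)
  -- (a) `H² = Σ_d S(d)` and `S(0) = H`
  have hsq : H * H = ∑ d, S d := sum_mul_sum_eq_sum_sum_shift P
  have hS0 : S 0 = H := by
    simp only [hS, hH, add_zero, hidem]
  -- (b) the residues `d` enumerated as `0, 1, 2, …, N-2, N-1 = -1`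
  have hsumS : ∑ d, S d = ∑ t ∈ range N, S (t : ZMod N) := by
    refine sum_nbij' (fun d => d.val) (fun t => (t : ZMod N)) (fun d _ => ?_) (fun _ _ => mem_univ _)
      (fun d _ => ZMod.natCast_zmod_val d) (fun t ht => ?_) (fun d _ => by rw [ZMod.natCast_zmod_val])
    · exact mem_range.2 (ZMod.val_lt d)
    · rw [mem_range] at ht
      rw [ZMod.val_natCast, Nat.mod_eq_of_lt ht]
  have hsplit : ∑ d, S d = S 0 + S 1 + ∑ t ∈ Ico 2 (N - 1), S (t : ZMod N) + S (-1) := by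
    rw [hsumS, range_eq_Ico, sum_eq_sum_Ico_succ_bot (by omega), sum_eq_sum_Ico_succ_bot (by omega),
      show Ico (0 + 1 + 1) N = Ico 2 (N - 1 + 1) by congr 1; omega, sum_Ico_succ_top (by omega),
      hm1]
    push_cast
    abel
  -- (c) the block sums: `Σ_i A_i = b H` and `Σ_i A_i² = Σ_{j,l<b} S(l - j)`
  have hsumA : ∑ i, A i = (b : ℂ) • H := by
    simp only [hA, hH]
    rw [sum_comm]
    simp only [sum_shift (fun i => P i)]
    rw [sum_const, card_range, ← Nat.cast_smul_eq_nsmul ℂ]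
  have hsumA2 : ∑ i, A i * A i =
      ∑ j ∈ range b, ∑ l ∈ range b, S ((l : ZMod N) - (j : ZMod N)) := by
    simp only [hA, sum_mul_sum]
    rw [sum_comm]
    refine sum_congr rfl fun j _ => ?_
    rw [sum_comm]
    refine sum_congr rfl fun l _ => ?_
    have e : ∀ i : ZMod N, P (i + (j : ZMod N)) * P (i + (l : ZMod N)) =
        P (i + (j : ZMod N)) * P (i + (j : ZMod N) + ((l : ZMod N) - (j : ZMod N))) := by
      intro i; congr 2; abel
    simp only [e]
    exact Equiv.sum_comp (Equiv.addRight (j : ZMod N)) (fun i => P i * P (i + ((l : ZMod N) - (j : ZMod N))))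
  -- (d) pair-difference resummation, split off `t = 0, 1`
  have hF := sum_range_sum_range_sub_natCast S b
  have hF' : ∑ j ∈ range b, ∑ l ∈ range b, S ((l : ZMod N) - (j : ZMod N)) + b • S 0 =
      b • (S 0 + S 0) + (b - 1) • (S 1 + S (-1)) +
        ∑ t ∈ Ico 2 b, (b - t) • (S (t : ZMod N) + S (-(t : ZMod N))) := by
    rw [hF, range_eq_Ico, sum_eq_sum_Ico_succ_bot (by omega), sum_eq_sum_Ico_succ_bot (by omega)]
    push_cast
    rw [neg_zero, Nat.sub_zero, add_assoc]
  -- (e) extend the window sums to `2 ≤ t ≤ N - 2` (coefficients vanish for `t ≥ b`) and reflect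
  have hsub : Ico 2 b ⊆ Ico 2 (N - 1) := Ico_subset_Ico_right (by omega)
  have hext1 : ∑ t ∈ Ico 2 b, (b - t) • S (t : ZMod N) =
      ∑ t ∈ Ico 2 (N - 1), (b - t) • S (t : ZMod N) := by
    refine sum_subset hsub fun t ht ht' => ?_
    rw [mem_Ico] at ht ht'
    rw [show b - t = 0 by omega, zero_smul]
  have hext2 : ∑ t ∈ Ico 2 b, (b - t) • S (-(t : ZMod N)) =
      ∑ t ∈ Ico 2 (N - 1), (b - (N - t)) • S (t : ZMod N) := by
    have h1 : ∑ t ∈ Ico 2 b, (b - t) • S (-(t : ZMod N)) =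
        ∑ t ∈ Ico 2 (N - 1), (b - t) • S (-(t : ZMod N)) := by
      refine sum_subset hsub fun t ht ht' => ?_
      rw [mem_Ico] at ht ht'
      rw [show b - t = 0 by omega, zero_smul]
    have h2 := sum_Ico_reflect (fun s => (b - (N - s)) • S (s : ZMod N)) 2 (m := N - 1) (n := N)
      (by omega)
    rw [show N + 1 - (N - 1) = 2 by omega, show N + 1 - 2 = N - 1 by omega] at h2
    rw [h1, ← h2]
    refine sum_congr rfl fun t ht => ?_
    rw [mem_Ico] at ht
    rw [show N - (N - t) = t by omega, Nat.cast_sub (by omega : t ≤ N), ZMod.natCast_self, zero_sub]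
  -- (f) the remainder `E = Σ_{t=2}^{N-2} ((b-1) - (b-t) - (b-(N-t))) S(t)` is positive
  set E : Matrix n n ℂ :=
    ∑ t ∈ Ico 2 (N - 1), ((b - 1 - ((b - t) + (b - (N - t))) : ℕ) : ℂ) • S (t : ZMod N) with hE
  have hEpos : E.PosSemidef := by
    refine posSemidef_sum _ fun t ht => ?_
    rw [mem_Ico] at ht
    refine PosSemidef.smul (hSpos _ (hne0 t ht.1 ht.2) (hne1 t ht.1 ht.2) (hnem1 t ht.1 ht.2)) ?_
    rw [show (((b - 1 - ((b - t) + (b - (N - t))) : ℕ) : ℂ)) =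
      (((b - 1 - ((b - t) + (b - (N - t))) : ℕ) : ℝ) : ℂ) by norm_cast]
    exact Complex.zero_le_real.2 (Nat.cast_nonneg _)
  have hEeq : E = ((b - 1 : ℕ) : ℂ) • ∑ t ∈ Ico 2 (N - 1), S (t : ZMod N) -
      ∑ t ∈ Ico 2 (N - 1), ((b - t : ℕ) : ℂ) • S (t : ZMod N) -
      ∑ t ∈ Ico 2 (N - 1), ((b - (N - t) : ℕ) : ℂ) • S (t : ZMod N) := by
    rw [hE, smul_sum, ← sum_sub_distrib, ← sum_sub_distrib]
    refine sum_congr rfl fun t ht => ?_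
    rw [mem_Ico] at ht
    have hle : (b - t) + (b - (N - t)) ≤ b - 1 := by omega
    rw [Nat.cast_sub hle, Nat.cast_add, sub_smul, add_smul]
    abel
  -- (g) the exact identity `(b-1) H² - (bε - 1) H = Σ_i (A_i² - ε A_i) + E`
  have hb1 : ((b - 1 : ℕ) : ℂ) = (b : ℂ) - 1 := by
    rw [Nat.cast_sub (by omega : 1 ≤ b), Nat.cast_one]
  have hA2 : ∑ i, A i * A i = (b : ℂ) • H + ((b : ℂ) - 1) • (S 1 + S (-1)) +
      ∑ t ∈ Ico 2 (N - 1), ((b - t : ℕ) : ℂ) • S (t : ZMod N) +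
      ∑ t ∈ Ico 2 (N - 1), ((b - (N - t) : ℕ) : ℂ) • S (t : ZMod N) := by
    have h := hF'
    rw [← hsumA2] at h
    simp only [smul_add, sum_add_distrib] at h
    rw [hext1, hext2, hS0] at h
    simp only [← Nat.cast_smul_eq_nsmul ℂ] at h
    rw [hb1] at h
    -- cancel `b • H` on both sides
    have h' : ∑ i, A i * A i = (∑ i, A i * A i + (b : ℂ) • H) - (b : ℂ) • H := by
      rw [add_sub_cancel_right]
    rw [h', h]
    module
  have hid : ((b : ℂ) - 1) • (H * H) - (((b * ε - 1 : ℝ)) : ℂ) • H =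
      ∑ i, (A i * A i - (ε : ℂ) • A i) + E := by
    rw [sum_sub_distrib, ← smul_sum, hA2, hsumA, hEeq, hsq, hsplit, hS0, hb1]
    push_cast
    module
  -- (h) conclusion
  have hbpos : (0 : ℝ) < (b : ℝ) - 1 := by
    have : (2 : ℝ) ≤ b := by exact_mod_cast hb
    linarith
  have hT : (((b : ℂ) - 1) • (H * H) - (((b * ε - 1 : ℝ)) : ℂ) • H).PosSemidef := by
    rw [hid]
    exact (posSemidef_sum _ fun i _ => hloc i).add hEpos
  have hscale : H * H - (((b * ε - 1) / (b - 1) : ℝ) : ℂ) • H =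
      (((b - 1)⁻¹ : ℝ) : ℂ) • (((b : ℂ) - 1) • (H * H) - (((b * ε - 1 : ℝ)) : ℂ) • H) := by
    rw [smul_sub, smul_smul, smul_smul]
    have h1 : (((b - 1)⁻¹ : ℝ) : ℂ) * ((b : ℂ) - 1) = 1 := by
      rw [show ((b : ℂ) - 1) = (((b : ℝ) - 1 : ℝ) : ℂ) by push_cast; ring]
      rw [← Complex.ofReal_mul, inv_mul_cancel₀ hbpos.ne', Complex.ofReal_one]
    rw [h1, one_smul, ← Complex.ofReal_mul, div_eq_inv_mul]
  rw [hscale]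
  exact hT.smul (Complex.zero_le_real.2 (inv_nonneg.2 hbpos.le))


/-! ### The printed parametrisation and the eigenvalue reading -/

/-- **Knabe's criterion, parametrised by the number of sites of a block** (`n ≥ 3` sites = `n - 1` bond
projections per block, ring of `N ≥ n + 1` bonds, i.e. `m > n`): local gap `ε` on every block ⇒
`H² - ((n-1)/(n-2)) (ε - 1/(n-1)) H ≥ 0`.  [cite: Knabe1988, §2 Thm. 1] [cite: GossetMozgunov2016, Thm. 1] -/
theorem knabe_ring_sq_sub_smul_posSemidef_sites {N : ℕ} [NeZero N] {ns : ℕ} (hns : 3 ≤ ns)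
    (hN : ns + 1 ≤ N) (P : ZMod N → Matrix n n ℂ) (hherm : ∀ i, (P i).IsHermitian)
    (hidem : ∀ i, P i * P i = P i)
    (hcomm : ∀ i d : ZMod N, d ≠ 0 → d ≠ 1 → d ≠ -1 → P i * P (i + d) = P (i + d) * P i)
    (ε : ℝ)
    (hloc : ∀ i : ZMod N,
      ((∑ j ∈ range (ns - 1), P (i + (j : ZMod N))) * (∑ j ∈ range (ns - 1), P (i + (j : ZMod N))) -
        (ε : ℂ) • ∑ j ∈ range (ns - 1), P (i + (j : ZMod N))).PosSemidef) :
    ((∑ i, P i) * (∑ i, P i) -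
      ((((ns : ℝ) - 1) / ((ns : ℝ) - 2) * (ε - 1 / ((ns : ℝ) - 1)) : ℝ) : ℂ) • ∑ i, P i).PosSemidef := by
  have h := knabe_ring_block_sq_sub_smul_posSemidef (b := ns - 1) (by omega) (by omega) P hherm hidem
    hcomm ε hloc
  have hcoef : (((ns - 1 : ℕ) : ℝ) * ε - 1) / (((ns - 1 : ℕ) : ℝ) - 1) =
      ((ns : ℝ) - 1) / ((ns : ℝ) - 2) * (ε - 1 / ((ns : ℝ) - 1)) := by
    have h1 : ((ns - 1 : ℕ) : ℝ) = (ns : ℝ) - 1 := by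
      rw [Nat.cast_sub (by omega), Nat.cast_one]
    have h2 : (ns : ℝ) - 1 ≠ 0 := by
      have : (3 : ℝ) ≤ ns := by exact_mod_cast hns
      linarith
    have h3 : (ns : ℝ) - 2 ≠ 0 := by
      have : (3 : ℝ) ≤ ns := by exact_mod_cast hns
      linarith
    rw [h1, show (ns : ℝ) - 1 - 1 = (ns : ℝ) - 2 by ring]
    field_simp
  rw [← hcoef]
  exact h

/-- **Reading lemma.** If `A ≥ 0` and `A² - c A ≥ 0`, then every eigenvalue `μ` of `A` (with eigenvector
`v ≠ 0`, `A v = μ v`) is `0` or at least `c`: `⟨v, (A² - cA) v⟩ = (μ² - cμ) ‖v‖² ≥ 0` and `μ ≥ 0`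
— the reading of a quadratic operator inequality as a bound on the smallest non-zero eigenvalue used in
Knabe 1988 §2 and Gosset–Mozgunov §2.1 ("`(H°_m)² ≥ αγ(ε_n - β/(αγ)) H°_m`, which establishes that
`ε°_m ≥ αγ(ε_n - β/(αγ))`"). [cite: GossetMozgunov2016, §2.1] [cite: Knabe1988, §2] -/
theorem eigenvalue_eq_zero_or_le_of_sq_sub_smul_posSemidef {A : Matrix n n ℂ} {c μ : ℝ}
    (hA : A.PosSemidef) (hsq : (A * A - (c : ℂ) • A).PosSemidef) {v : n → ℂ}
    (hv : A *ᵥ v = (μ : ℂ) • v) (hv0 : v ≠ 0) : μ = 0 ∨ c ≤ μ := by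
  -- `p = ⟨v, v⟩ > 0`, real
  have hp : 0 < star v ⬝ᵥ v := dotProduct_star_self_pos_iff.2 hv0
  obtain ⟨hpre, hpim⟩ := Complex.pos_iff.1 hp
  -- `μ ≥ 0` from `A ≥ 0`
  have h1 := hA.dotProduct_mulVec_nonneg v
  rw [hv, dotProduct_smul, smul_eq_mul, Complex.le_def] at h1
  have hμ0 : 0 ≤ μ := by
    have h := h1.1
    rw [Complex.zero_re, Complex.re_ofReal_mul] at h
    nlinarith
  -- `μ² - cμ ≥ 0` from `A² - cA ≥ 0`
  have hMv : (A * A - (c : ℂ) • A) *ᵥ v = ((μ * μ - c * μ : ℝ) : ℂ) • v := by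
    rw [sub_mulVec, ← mulVec_mulVec, hv, mulVec_smul, hv, smul_mulVec, hv, smul_smul, smul_smul,
      ← sub_smul]
    push_cast
    ring_nf
  have h2 := hsq.dotProduct_mulVec_nonneg v
  rw [hMv, dotProduct_smul, smul_eq_mul, Complex.le_def] at h2
  have hq : 0 ≤ μ * μ - c * μ := by
    have h := h2.1
    rw [Complex.zero_re, Complex.re_ofReal_mul] at h
    nlinarith
  by_cases hμ : μ = 0
  · exact Or.inl hμ
  · right
    have hμpos : 0 < μ := lt_of_le_of_ne hμ0 (Ne.symm hμ)
    nlinarith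

/-- ★ **Knabe's Theorem 1 in its printed form**: under the hypotheses of
`knabe_ring_block_sq_sub_smul_posSemidef` (ring of `N ≥ b + 2` nearest-neighbour bond projections, every block
of `b ≥ 2` consecutive projections with local gap `ε`), every NON-ZERO eigenvalue of `H = Σ_i P_i` is at least
`(bε - 1)/(b - 1) = ((n-1)/(n-2))(ε - 1/(n-1))` (`n = b + 1`): "`ε°_m ≥ ((n-1)/(n-2))(ε_n - 1/(n-1))`",
`m = N > n`.  [cite: Knabe1988, §2 Thm. 1] [cite: GossetMozgunov2016, Thm. 1] -/
theorem knabe_ring_block_eigenvalue_eq_zero_or_le {N : ℕ} [NeZero N] {b : ℕ} (hb : 2 ≤ b)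
    (hN : b + 2 ≤ N) (P : ZMod N → Matrix n n ℂ) (hherm : ∀ i, (P i).IsHermitian)
    (hidem : ∀ i, P i * P i = P i)
    (hcomm : ∀ i d : ZMod N, d ≠ 0 → d ≠ 1 → d ≠ -1 → P i * P (i + d) = P (i + d) * P i)
    (ε : ℝ)
    (hloc : ∀ i : ZMod N,
      ((∑ j ∈ range b, P (i + (j : ZMod N))) * (∑ j ∈ range b, P (i + (j : ZMod N))) -
        (ε : ℂ) • ∑ j ∈ range b, P (i + (j : ZMod N))).PosSemidef)
    {μ : ℝ} {v : n → ℂ} (hv : (∑ i, P i) *ᵥ v = (μ : ℂ) • v) (hv0 : v ≠ 0) :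
    μ = 0 ∨ (b * ε - 1) / (b - 1) ≤ μ := by
  have hH : (∑ i, P i).PosSemidef :=
    posSemidef_sum _ fun i _ => posSemidef_of_isHermitian_of_mul_self (hherm i) (hidem i)
  exact eigenvalue_eq_zero_or_le_of_sq_sub_smul_posSemidef hH
    (knabe_ring_block_sq_sub_smul_posSemidef hb hN P hherm hidem hcomm ε hloc) hv hv0

end KnabeBlock

end Literature.MathematicalPhysics.QuantumLattice

end
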